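import Mathlib
import HarnessLib
import Literature.MathematicalPhysics.QuantumLattice.HubbardGridCharactersWeighted
import Literature.MathematicalPhysics.QuantumLattice.HubbardSpaceTimeCharacters
import Literature.MathematicalPhysics.QuantumLattice.HubbardUVSymbolCTDifferences
import Summits.HubbardSuperconductivity.HubbardSuperconductivity.Theorems.KLProgrammeKLRegimeEngineScaleZeroTimeMoment
import Summits.HubbardSuperconductivity.HubbardSuperconductivity.Theorems.KLProgrammeKLRegimeEngineScaleZeroE4SpaceMoment
import Summits.HubbardSuperconductivity.HubbardSuperconductivity.Theorems.KLProgrammeKLRegimeEngineScaleZeroValuesExplicit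
import Summits.HubbardSuperconductivity.HubbardSuperconductivity.Theorems.KLProgrammeKLRegimeEngineScaleZeroE4GridVertex

/-!
# K3 engine, scale `0`: the `gridLabelWt`-WEIGHTED decay constant `α_w` of the pulled-back scale-`0` covariance `S_NᵀC^K_{>e₀}S_N`
# — `hrow`/`hcol` of (E4)₀ and of the two-leg first moments, ASSEMBLED from the three landed torus sums

Cell gate-hubbard-kl, seat p3 g8 (packaging step of k3c2-p1's (E4)₀ design X9; TAKE line KL STATUS 10:33Z).  The pair weight is
`gridLabelWt {pos X, pos Y} = 1 + (β/N)·cyclicDist_N(j_X, j_Y) + torusSiteDist(x⃗_X, x⃗_Y)` (`gridLabelWt_pair`), so the weighted row sum splits into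
the PLAIN row sum (`rowSum_scaleZero_le_A0`: `≤ (N/β)·klScaleZeroA0`, k3c4-p2 / p3 g6), the TIME-weighted one (k3c4-p2's torus time moment
`timeMoment_scaleZero_of_klEng`: `(β/N)Σ(β/N)|ã|‖S‖ ≤ uvTimeMomentConst klE0 7 32`) and the SPACE-weighted one (`torusSiteDist ≤ |b̃₀| + |b̃₁|` and
k3c2-p1's `spaceMoment_scaleZero_of_frameOK` in both directions), the last two transported to the grid by
`HubbardGridCharactersWeighted.sum_norm_mul_gridSub_pullback_row/col_le_of_weight` (even weights of the difference point).  Result: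

* **`rowSum_scaleZero_gridLabelWt_le`** / **`colSum_scaleZero_gridLabelWt_le`** — for an admissible frame (`FrameOK R U Nsc μ K`, `R.WF`, `|U| ≤ 1`),
  `klBetaMin ≤ β`, `klEngL₃ β U ≤ L`, `klEngM₃ β U L ≤ M`, cutoff derivatives `≤ B` up to order `5` (`1 ≤ B`), on the `N = 4M` grid:
  `Σ_Y ‖(S_NᵀC^K_{>e₀}S_N) X Y‖ · gridLabelWt L N β {gridLegPos X, gridLegPos Y} ≤ (N/β)·(klScaleZeroA0 + uvTimeMomentConst klE0 7 32 + 2·X_R(B,U,Nsc))`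
  with `X_R` the space-moment constant of `spaceMoment_scaleZero_of_frameOK` (written out) — the `hrow`/`hcol ≤ α_w` hypotheses of
  `…ScaleZeroE4Assembly`, `…VertexOnlyTwoLegMoments`, `…ResummedDecayNormal` (`α̃_w = 2α_w`) with `(β/N)·α_w = O(1) + O((Nsc+1)U² + |U|)`.

Everything is proved; no definitions, no named facts, no sorry.  `--supports stmt-HubbardSuperconductivity-20236` (helper).
-/

noncomputable section

namespace Summit.HubbardSuperconductivity.HubbardSuperconductivity.Theorems.EngineV8

set_option linter.dupNamespace false -- summit = problem name (single-conjunct summit), D-0017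

open Real Finset Literature.MathematicalPhysics.QuantumLattice Literature.Probability.LatticeModels
open Summit.HubbardSuperconductivity.HubbardSuperconductivity.Theorems.KLRegimeSplit
open Summit.HubbardSuperconductivity.HubbardSuperconductivity.Theorems.ScaleZeroDecay

variable {L M : ℕ} [NeZero L] [NeZero M] {R : RenConsts} {U β μ : ℝ} {Nsc : ℕ} {K : TrigPolyC4v}

/-! ## §1 The two partial weights on the product torus -/

/-- `cyclicDist_N(a, 0) = |ã|` (centred representative). -/
private theorem cyclicDist_zero_eq_abs_valMinAbs' {N : ℕ} [NeZero N] (a : ZMod N) : cyclicDist N a 0 = |((a.valMinAbs : ℤ) : ℝ)| := by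
  rw [cyclicDist, sub_zero, ← ZMod.valMinAbs_natAbs_eq_min, Nat.cast_natAbs, Int.cast_abs]

/-- The time weight `(β/N)·cyclicDist_N(a, 0)` is even. -/
theorem cyclicDist_neg_zero {N : ℕ} [NeZero N] (a : ZMod N) : cyclicDist N (-a) 0 = cyclicDist N a 0 := by
  rw [(isLabelDist_cyclicDist N).symm (-a) 0, cyclicDist, cyclicDist, zero_sub, neg_neg, sub_zero]

/-- The space weight `torusSiteDist(b⃗, 0)` is even. -/
theorem torusSiteDist_neg_zero (bv : TorusSite 2 L) : torusSiteDist (-bv) 0 = torusSiteDist bv 0 := by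
  rw [isLabelDist_torusSiteDist.symm (-bv) 0, torusSiteDist_eq_sub_zero (0 : TorusSite 2 L) (-bv), zero_sub, neg_neg]

/-- `cyclicDist_N(a, b) = cyclicDist_N(a − b, 0)`. -/
private theorem cyclicDist_eq_sub_zero' {N : ℕ} (a b : ZMod N) : cyclicDist N a b = cyclicDist N (a - b) 0 := by
  rw [cyclicDist, cyclicDist, sub_zero]

/-- **The leg-pair weight splits**: `gridLabelWt {pos X, pos Y} = 1 + (β/N)·cyclicDist_N(j_X − j_Y, 0) + torusSiteDist(x⃗_X − x⃗_Y, 0)`. -/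
theorem gridLabelWt_legPair_eq_split {N : ℕ} [NeZero N] {β' : ℝ} (hβ' : 0 ≤ β') (X Y : GridLeg (GridPoint L N)) :
    gridLabelWt L N β' {gridLegPos X, gridLegPos Y} =
      1 + β' / N * cyclicDist N (((X.1.1.1 : ℕ) : ZMod N) - ((Y.1.1.1 : ℕ) : ZMod N)) 0 + torusSiteDist (X.1.1.2 - Y.1.1.2) 0 := by
  rw [gridLabelWt_pair L N hβ', gridLegPos_apply, gridLegPos_apply, gridLabelDist_apply, cyclicDist_eq_sub_zero',
    torusSiteDist_eq_sub_zero X.1.1.2, add_assoc]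

/-! ## §2 The weighted row and column sums -/

section AlphaW

variable [h4 : NeZero (2 * (2 * M))]

/-- **`hrow ≤ α_w`** — the `gridLabelWt`-weighted row sums of the pulled-back scale-`0` covariance of an admissible frame on the `4M` grid:
`Σ_Y ‖(S_NᵀC^K_{>e₀}S_N) X Y‖·wt{pos X, pos Y} ≤ (N/β)·(klScaleZeroA0 + uvTimeMomentConst klE0 7 32 + 2·X_R)` (plain + time + space). -/
theorem rowSum_scaleZero_gridLabelWt_le (hK : FrameOK R U Nsc μ K) (hR : R.WF) (hU1 : |U| ≤ 1) (hβ : klBetaMin ≤ β)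
    (hL : klEngL₃ β U ≤ L) (hM : klEngM₃ β U L ≤ M) {B : ℝ} (hB1 : 1 ≤ B) (hB : ∀ i ≤ 5, ∀ t, ‖iteratedDeriv i salmhoferCutoff t‖ ≤ B)
    (X : GridLeg (GridPoint L (2 * (2 * M)))) :
    ∑ Y : GridLeg (GridPoint L (2 * (2 * M))),
        ‖((hubbardGridSub L M β (2 * (2 * M))).transpose * hubbardCovAboveCT L M β μ 0 K klE0 * hubbardGridSub L M β (2 * (2 * M))) X Y‖ *
          gridLabelWt L (2 * (2 * M)) β {gridLegPos X, gridLegPos Y} ≤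
      (((2 * (2 * M) : ℕ) : ℝ)) / β *
        (klScaleZeroA0 + uvTimeMomentConst klE0 7 32 +
          2 * (uvSpaceMomentConst klE0 1 (uvPieceSq klE0 (uvBaseQ B klE0 4) (uvBaseQ' B klE0 4)) +
            (1 / 4 * Real.sqrt (216 * (1 / klE0 + 1 / 2)) *
                ∑ e : Fin 2 × Fin 2, (uvLinV klE0 (1 + (e.1 : ℕ) + (e.2 : ℕ)) *
                    (B * ((1 + ((e.1 : ℕ) + (e.2 : ℕ)) + 2).factorial : ℝ) * (4 / klE0) ^ (1 + ((e.1 : ℕ) + (e.2 : ℕ)) + 1)) +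
                  uvLinD klE0 (1 + (e.1 : ℕ) + (e.2 : ℕ)) *
                    (B * ((1 + ((e.1 : ℕ) + (e.2 : ℕ)) + 3).factorial : ℝ) * (4 / klE0) ^ (1 + ((e.1 : ℕ) + (e.2 : ℕ)) + 2)))) *
              (4608 * (1 + R.Gfr 0 + R.Gfr 1 + R.Gfr 2 + R.Gfr 3) ^ 4 * (((Nsc : ℝ) + 1) * U ^ 2 + 2 * |U|)))) := by
  have hβ0 : 0 < β := beta_pos_of_klBetaMin_le hβ
  have hβM : β ^ 3 ≤ (M : ℝ) := pow_three_le_of_klEng hβ hL hM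
  have hMN : 2 * M ≤ 2 * (2 * M) := by omega
  have hNgpos : 0 < (((2 * (2 * M) : ℕ) : ℝ)) := by have := NeZero.ne M; positivity
  set G := (hubbardGridSub L M β (2 * (2 * M))).transpose * hubbardCovAboveCT L M β μ 0 K klE0 * hubbardGridSub L M β (2 * (2 * M)) with hGdef
  have hGn : G = (hubbardGridSub L M β (2 * (2 * M))).transpose * normalCovariance L M (uvSymbolCT L M β μ K klE0) * hubbardGridSub L M β (2 * (2 * M)) := by
    rw [hGdef, hubbardCovAboveCT_zero_seed_eq_normalCovariance_uvSymbolCT]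
  -- abbreviations for the three constants
  set T : ℝ := uvTimeMomentConst klE0 7 32 with hT
  set XR : ℝ := uvSpaceMomentConst klE0 1 (uvPieceSq klE0 (uvBaseQ B klE0 4) (uvBaseQ' B klE0 4)) +
      (1 / 4 * Real.sqrt (216 * (1 / klE0 + 1 / 2)) *
          ∑ e : Fin 2 × Fin 2, (uvLinV klE0 (1 + (e.1 : ℕ) + (e.2 : ℕ)) *
              (B * ((1 + ((e.1 : ℕ) + (e.2 : ℕ)) + 2).factorial : ℝ) * (4 / klE0) ^ (1 + ((e.1 : ℕ) + (e.2 : ℕ)) + 1)) +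
            uvLinD klE0 (1 + (e.1 : ℕ) + (e.2 : ℕ)) *
              (B * ((1 + ((e.1 : ℕ) + (e.2 : ℕ)) + 3).factorial : ℝ) * (4 / klE0) ^ (1 + ((e.1 : ℕ) + (e.2 : ℕ)) + 2)))) *
        (4608 * (1 + R.Gfr 0 + R.Gfr 1 + R.Gfr 2 + R.Gfr 3) ^ 4 * (((Nsc : ℝ) + 1) * U ^ 2 + 2 * |U|)) with hXR
  -- (1) the plain part
  have hplain : ∑ Y : GridLeg (GridPoint L (2 * (2 * M))), ‖G X Y‖ ≤ (((2 * (2 * M) : ℕ) : ℝ)) / β * klScaleZeroA0 := rowSum_scaleZero_le_A0 (L := L) hK hβ hβM X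
  -- (2) the time part, from the torus time moment
  have hTsum : ∀ σ : Fin 2, ∑ a : TorusSite 1 (2 * (2 * M)), ∑ bv : TorusSite 2 L,
      (β / (((2 * (2 * M) : ℕ) : ℝ)) * cyclicDist (2 * (2 * M)) (a 0) 0) * ‖∑ q₀ : TorusSite 1 (2 * (2 * M)), ∑ qv : TorusSite 2 L, torusChar q₀ a * torusChar qv bv *
        gridSymbol L M (2 * (2 * M)) β (uvSymbolCT L M β μ K klE0) σ q₀ qv‖ ≤ (((2 * (2 * M) : ℕ) : ℝ)) / β * T := by
    intro σ
    have h := timeMoment_scaleZero_of_klEng (L := L) (N := (2 * (2 * M))) hK hβ hL hM hMN σ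
    simp_rw [cyclicDist_zero_eq_abs_valMinAbs']
    rw [show (((2 * (2 * M) : ℕ) : ℝ)) / β * T = (β / (((2 * (2 * M) : ℕ) : ℝ)))⁻¹ * T by rw [inv_div]]
    exact (le_inv_mul_iff₀ (by positivity)).2 h
  have htime : ∑ Y : GridLeg (GridPoint L (2 * (2 * M))), ‖G X Y‖ *
      (β / (((2 * (2 * M) : ℕ) : ℝ)) * cyclicDist (2 * (2 * M)) (((X.1.1.1 : ℕ) : ZMod (2 * (2 * M))) - ((Y.1.1.1 : ℕ) : ZMod (2 * (2 * M)))) 0) ≤ (((2 * (2 * M) : ℕ) : ℝ)) / β * T := by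
    have h := sum_norm_mul_gridSub_pullback_row_le_of_weight (L := L) (M := M) (N := (2 * (2 * M))) hβ0.ne' hMN (uvSymbolCT L M β μ K klE0)
      (fun a _ => β / (((2 * (2 * M) : ℕ) : ℝ)) * cyclicDist (2 * (2 * M)) (a 0) 0) (fun a bv => by simp only [Pi.neg_apply, cyclicDist_neg_zero]) hTsum X
    rw [hGn]
    simpa only using h
  -- (3) the space part, from the torus space moments in both directions
  have hXsum : ∀ σ : Fin 2, ∑ a : TorusSite 1 (2 * (2 * M)), ∑ bv : TorusSite 2 L,
      torusSiteDist bv 0 * ‖∑ q₀ : TorusSite 1 (2 * (2 * M)), ∑ qv : TorusSite 2 L, torusChar q₀ a * torusChar qv bv *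
        gridSymbol L M (2 * (2 * M)) β (uvSymbolCT L M β μ K klE0) σ q₀ qv‖ ≤ (((2 * (2 * M) : ℕ) : ℝ)) / β * (2 * XR) := by
    intro σ
    have h0 := spaceMoment_scaleZero_of_frameOK (L := L) (N := (2 * (2 * M))) hK hR hU1 hβ hβM hMN hB1 hB (l := 0) (l' := 1) (by decide) σ
    have h1 := spaceMoment_scaleZero_of_frameOK (L := L) (N := (2 * (2 * M))) hK hR hU1 hβ hβM hMN hB1 hB (l := 1) (l' := 0) (by decide) σ
    have hsum : β / (((2 * (2 * M) : ℕ) : ℝ)) * ∑ a : TorusSite 1 (2 * (2 * M)), ∑ bv : TorusSite 2 L,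
        (|(((bv 0).valMinAbs : ℤ) : ℝ)| + |(((bv 1).valMinAbs : ℤ) : ℝ)|) *
          ‖∑ q₀ : TorusSite 1 (2 * (2 * M)), ∑ qv : TorusSite 2 L, torusChar q₀ a * torusChar qv bv *
            gridSymbol L M (2 * (2 * M)) β (uvSymbolCT L M β μ K klE0) σ q₀ qv‖ ≤ 2 * XR := by
      rw [hXR]
      have : β / (((2 * (2 * M) : ℕ) : ℝ)) * ∑ a : TorusSite 1 (2 * (2 * M)), ∑ bv : TorusSite 2 L,
          (|(((bv 0).valMinAbs : ℤ) : ℝ)| + |(((bv 1).valMinAbs : ℤ) : ℝ)|) *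
            ‖∑ q₀ : TorusSite 1 (2 * (2 * M)), ∑ qv : TorusSite 2 L, torusChar q₀ a * torusChar qv bv *
              gridSymbol L M (2 * (2 * M)) β (uvSymbolCT L M β μ K klE0) σ q₀ qv‖ =
          β / (((2 * (2 * M) : ℕ) : ℝ)) * ∑ a : TorusSite 1 (2 * (2 * M)), ∑ bv : TorusSite 2 L, |(((bv 0).valMinAbs : ℤ) : ℝ)| *
              ‖∑ q₀ : TorusSite 1 (2 * (2 * M)), ∑ qv : TorusSite 2 L, torusChar q₀ a * torusChar qv bv *
                gridSymbol L M (2 * (2 * M)) β (uvSymbolCT L M β μ K klE0) σ q₀ qv‖ +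
            β / (((2 * (2 * M) : ℕ) : ℝ)) * ∑ a : TorusSite 1 (2 * (2 * M)), ∑ bv : TorusSite 2 L, |(((bv 1).valMinAbs : ℤ) : ℝ)| *
              ‖∑ q₀ : TorusSite 1 (2 * (2 * M)), ∑ qv : TorusSite 2 L, torusChar q₀ a * torusChar qv bv *
                gridSymbol L M (2 * (2 * M)) β (uvSymbolCT L M β μ K klE0) σ q₀ qv‖ := by
        rw [← mul_add, ← sum_add_distrib]
        congr 1
        refine sum_congr rfl fun a _ => ?_
        rw [← sum_add_distrib]
        exact sum_congr rfl fun bv _ => by ring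
      rw [this]
      linarith
    have hle : ∑ a : TorusSite 1 (2 * (2 * M)), ∑ bv : TorusSite 2 L,
        torusSiteDist bv 0 * ‖∑ q₀ : TorusSite 1 (2 * (2 * M)), ∑ qv : TorusSite 2 L, torusChar q₀ a * torusChar qv bv *
          gridSymbol L M (2 * (2 * M)) β (uvSymbolCT L M β μ K klE0) σ q₀ qv‖ ≤
        ∑ a : TorusSite 1 (2 * (2 * M)), ∑ bv : TorusSite 2 L, (|(((bv 0).valMinAbs : ℤ) : ℝ)| + |(((bv 1).valMinAbs : ℤ) : ℝ)|) *
          ‖∑ q₀ : TorusSite 1 (2 * (2 * M)), ∑ qv : TorusSite 2 L, torusChar q₀ a * torusChar qv bv *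
            gridSymbol L M (2 * (2 * M)) β (uvSymbolCT L M β μ K klE0) σ q₀ qv‖ := by
      refine sum_le_sum fun a _ => sum_le_sum fun bv _ => mul_le_mul_of_nonneg_right ?_ (norm_nonneg _)
      have h := torusSiteDist_le_abs_add_abs bv 0
      rwa [sub_zero] at h
    calc _ ≤ _ := hle
      _ ≤ (β / (((2 * (2 * M) : ℕ) : ℝ)))⁻¹ * (2 * XR) := (le_inv_mul_iff₀ (by positivity)).2 hsum
      _ = (((2 * (2 * M) : ℕ) : ℝ)) / β * (2 * XR) := by rw [inv_div]
  have hspace : ∑ Y : GridLeg (GridPoint L (2 * (2 * M))), ‖G X Y‖ * torusSiteDist (X.1.1.2 - Y.1.1.2) 0 ≤ (((2 * (2 * M) : ℕ) : ℝ)) / β * (2 * XR) := by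
    have h := sum_norm_mul_gridSub_pullback_row_le_of_weight (L := L) (M := M) (N := (2 * (2 * M))) hβ0.ne' hMN (uvSymbolCT L M β μ K klE0)
      (fun _ bv => torusSiteDist bv 0) (fun a bv => by simp only [torusSiteDist_neg_zero]) hXsum X
    rw [hGn]
    simpa only using h
  -- assemble
  have hsplit : ∀ Y : GridLeg (GridPoint L (2 * (2 * M))), ‖G X Y‖ * gridLabelWt L (2 * (2 * M)) β {gridLegPos X, gridLegPos Y} =
      ‖G X Y‖ + ‖G X Y‖ * (β / (((2 * (2 * M) : ℕ) : ℝ)) * cyclicDist (2 * (2 * M)) (((X.1.1.1 : ℕ) : ZMod (2 * (2 * M))) - ((Y.1.1.1 : ℕ) : ZMod (2 * (2 * M)))) 0) +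
        ‖G X Y‖ * torusSiteDist (X.1.1.2 - Y.1.1.2) 0 := by
    intro Y
    rw [gridLabelWt_legPair_eq_split hβ0.le X Y]
    ring
  rw [sum_congr rfl fun Y _ => hsplit Y, sum_add_distrib, sum_add_distrib]
  have htot : (((2 * (2 * M) : ℕ) : ℝ)) / β * klScaleZeroA0 + (((2 * (2 * M) : ℕ) : ℝ)) / β * T + (((2 * (2 * M) : ℕ) : ℝ)) / β * (2 * XR) =
      (((2 * (2 * M) : ℕ) : ℝ)) / β * (klScaleZeroA0 + T + 2 * XR) := by ring
  rw [← htot]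
  exact add_le_add (add_le_add hplain htime) hspace

/-- **`hcol ≤ α_w`** — the same bound for the weighted column sums. -/
theorem colSum_scaleZero_gridLabelWt_le (hK : FrameOK R U Nsc μ K) (hR : R.WF) (hU1 : |U| ≤ 1) (hβ : klBetaMin ≤ β)
    (hL : klEngL₃ β U ≤ L) (hM : klEngM₃ β U L ≤ M) {B : ℝ} (hB1 : 1 ≤ B) (hB : ∀ i ≤ 5, ∀ t, ‖iteratedDeriv i salmhoferCutoff t‖ ≤ B)
    (Y : GridLeg (GridPoint L (2 * (2 * M)))) :
    ∑ X : GridLeg (GridPoint L (2 * (2 * M))),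
        ‖((hubbardGridSub L M β (2 * (2 * M))).transpose * hubbardCovAboveCT L M β μ 0 K klE0 * hubbardGridSub L M β (2 * (2 * M))) X Y‖ *
          gridLabelWt L (2 * (2 * M)) β {gridLegPos X, gridLegPos Y} ≤
      (((2 * (2 * M) : ℕ) : ℝ)) / β *
        (klScaleZeroA0 + uvTimeMomentConst klE0 7 32 +
          2 * (uvSpaceMomentConst klE0 1 (uvPieceSq klE0 (uvBaseQ B klE0 4) (uvBaseQ' B klE0 4)) +
            (1 / 4 * Real.sqrt (216 * (1 / klE0 + 1 / 2)) *
                ∑ e : Fin 2 × Fin 2, (uvLinV klE0 (1 + (e.1 : ℕ) + (e.2 : ℕ)) *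
                    (B * ((1 + ((e.1 : ℕ) + (e.2 : ℕ)) + 2).factorial : ℝ) * (4 / klE0) ^ (1 + ((e.1 : ℕ) + (e.2 : ℕ)) + 1)) +
                  uvLinD klE0 (1 + (e.1 : ℕ) + (e.2 : ℕ)) *
                    (B * ((1 + ((e.1 : ℕ) + (e.2 : ℕ)) + 3).factorial : ℝ) * (4 / klE0) ^ (1 + ((e.1 : ℕ) + (e.2 : ℕ)) + 2)))) *
              (4608 * (1 + R.Gfr 0 + R.Gfr 1 + R.Gfr 2 + R.Gfr 3) ^ 4 * (((Nsc : ℝ) + 1) * U ^ 2 + 2 * |U|)))) := by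
  have hβ0 : 0 < β := beta_pos_of_klBetaMin_le hβ
  have hβM : β ^ 3 ≤ (M : ℝ) := pow_three_le_of_klEng hβ hL hM
  have hMN : 2 * M ≤ 2 * (2 * M) := by omega
  have hNgpos : 0 < (((2 * (2 * M) : ℕ) : ℝ)) := by have := NeZero.ne M; positivity
  set G := (hubbardGridSub L M β (2 * (2 * M))).transpose * hubbardCovAboveCT L M β μ 0 K klE0 * hubbardGridSub L M β (2 * (2 * M)) with hGdef
  have hGn : G = (hubbardGridSub L M β (2 * (2 * M))).transpose * normalCovariance L M (uvSymbolCT L M β μ K klE0) * hubbardGridSub L M β (2 * (2 * M)) := by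
    rw [hGdef, hubbardCovAboveCT_zero_seed_eq_normalCovariance_uvSymbolCT]
  set T : ℝ := uvTimeMomentConst klE0 7 32 with hT
  set XR : ℝ := uvSpaceMomentConst klE0 1 (uvPieceSq klE0 (uvBaseQ B klE0 4) (uvBaseQ' B klE0 4)) +
      (1 / 4 * Real.sqrt (216 * (1 / klE0 + 1 / 2)) *
          ∑ e : Fin 2 × Fin 2, (uvLinV klE0 (1 + (e.1 : ℕ) + (e.2 : ℕ)) *
              (B * ((1 + ((e.1 : ℕ) + (e.2 : ℕ)) + 2).factorial : ℝ) * (4 / klE0) ^ (1 + ((e.1 : ℕ) + (e.2 : ℕ)) + 1)) +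
            uvLinD klE0 (1 + (e.1 : ℕ) + (e.2 : ℕ)) *
              (B * ((1 + ((e.1 : ℕ) + (e.2 : ℕ)) + 3).factorial : ℝ) * (4 / klE0) ^ (1 + ((e.1 : ℕ) + (e.2 : ℕ)) + 2)))) *
        (4608 * (1 + R.Gfr 0 + R.Gfr 1 + R.Gfr 2 + R.Gfr 3) ^ 4 * (((Nsc : ℝ) + 1) * U ^ 2 + 2 * |U|)) with hXR
  have hplain : ∑ X : GridLeg (GridPoint L (2 * (2 * M))), ‖G X Y‖ ≤ (((2 * (2 * M) : ℕ) : ℝ)) / β * klScaleZeroA0 := colSum_scaleZero_le_A0 (L := L) hK hβ hβM Y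
  have hTsum : ∀ σ : Fin 2, ∑ a : TorusSite 1 (2 * (2 * M)), ∑ bv : TorusSite 2 L,
      (β / (((2 * (2 * M) : ℕ) : ℝ)) * cyclicDist (2 * (2 * M)) (a 0) 0) * ‖∑ q₀ : TorusSite 1 (2 * (2 * M)), ∑ qv : TorusSite 2 L, torusChar q₀ a * torusChar qv bv *
        gridSymbol L M (2 * (2 * M)) β (uvSymbolCT L M β μ K klE0) σ q₀ qv‖ ≤ (((2 * (2 * M) : ℕ) : ℝ)) / β * T := by
    intro σ
    have h := timeMoment_scaleZero_of_klEng (L := L) (N := (2 * (2 * M))) hK hβ hL hM hMN σ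
    simp_rw [cyclicDist_zero_eq_abs_valMinAbs']
    rw [show (((2 * (2 * M) : ℕ) : ℝ)) / β * T = (β / (((2 * (2 * M) : ℕ) : ℝ)))⁻¹ * T by rw [inv_div]]
    exact (le_inv_mul_iff₀ (by positivity)).2 h
  have htime : ∑ X : GridLeg (GridPoint L (2 * (2 * M))), ‖G X Y‖ *
      (β / (((2 * (2 * M) : ℕ) : ℝ)) * cyclicDist (2 * (2 * M)) (((X.1.1.1 : ℕ) : ZMod (2 * (2 * M))) - ((Y.1.1.1 : ℕ) : ZMod (2 * (2 * M)))) 0) ≤ (((2 * (2 * M) : ℕ) : ℝ)) / β * T := by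
    have h := sum_norm_mul_gridSub_pullback_col_le_of_weight (L := L) (M := M) (N := (2 * (2 * M))) hβ0.ne' hMN (uvSymbolCT L M β μ K klE0)
      (fun a _ => β / (((2 * (2 * M) : ℕ) : ℝ)) * cyclicDist (2 * (2 * M)) (a 0) 0) (fun a bv => by simp only [Pi.neg_apply, cyclicDist_neg_zero]) hTsum Y
    rw [hGn]
    simpa only using h
  have hXsum : ∀ σ : Fin 2, ∑ a : TorusSite 1 (2 * (2 * M)), ∑ bv : TorusSite 2 L,
      torusSiteDist bv 0 * ‖∑ q₀ : TorusSite 1 (2 * (2 * M)), ∑ qv : TorusSite 2 L, torusChar q₀ a * torusChar qv bv *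
        gridSymbol L M (2 * (2 * M)) β (uvSymbolCT L M β μ K klE0) σ q₀ qv‖ ≤ (((2 * (2 * M) : ℕ) : ℝ)) / β * (2 * XR) := by
    intro σ
    have h0 := spaceMoment_scaleZero_of_frameOK (L := L) (N := (2 * (2 * M))) hK hR hU1 hβ hβM hMN hB1 hB (l := 0) (l' := 1) (by decide) σ
    have h1 := spaceMoment_scaleZero_of_frameOK (L := L) (N := (2 * (2 * M))) hK hR hU1 hβ hβM hMN hB1 hB (l := 1) (l' := 0) (by decide) σ
    have hsum : β / (((2 * (2 * M) : ℕ) : ℝ)) * ∑ a : TorusSite 1 (2 * (2 * M)), ∑ bv : TorusSite 2 L,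
        (|(((bv 0).valMinAbs : ℤ) : ℝ)| + |(((bv 1).valMinAbs : ℤ) : ℝ)|) *
          ‖∑ q₀ : TorusSite 1 (2 * (2 * M)), ∑ qv : TorusSite 2 L, torusChar q₀ a * torusChar qv bv *
            gridSymbol L M (2 * (2 * M)) β (uvSymbolCT L M β μ K klE0) σ q₀ qv‖ ≤ 2 * XR := by
      rw [hXR]
      have : β / (((2 * (2 * M) : ℕ) : ℝ)) * ∑ a : TorusSite 1 (2 * (2 * M)), ∑ bv : TorusSite 2 L,
          (|(((bv 0).valMinAbs : ℤ) : ℝ)| + |(((bv 1).valMinAbs : ℤ) : ℝ)|) *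
            ‖∑ q₀ : TorusSite 1 (2 * (2 * M)), ∑ qv : TorusSite 2 L, torusChar q₀ a * torusChar qv bv *
              gridSymbol L M (2 * (2 * M)) β (uvSymbolCT L M β μ K klE0) σ q₀ qv‖ =
          β / (((2 * (2 * M) : ℕ) : ℝ)) * ∑ a : TorusSite 1 (2 * (2 * M)), ∑ bv : TorusSite 2 L, |(((bv 0).valMinAbs : ℤ) : ℝ)| *
              ‖∑ q₀ : TorusSite 1 (2 * (2 * M)), ∑ qv : TorusSite 2 L, torusChar q₀ a * torusChar qv bv *
                gridSymbol L M (2 * (2 * M)) β (uvSymbolCT L M β μ K klE0) σ q₀ qv‖ +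
            β / (((2 * (2 * M) : ℕ) : ℝ)) * ∑ a : TorusSite 1 (2 * (2 * M)), ∑ bv : TorusSite 2 L, |(((bv 1).valMinAbs : ℤ) : ℝ)| *
              ‖∑ q₀ : TorusSite 1 (2 * (2 * M)), ∑ qv : TorusSite 2 L, torusChar q₀ a * torusChar qv bv *
                gridSymbol L M (2 * (2 * M)) β (uvSymbolCT L M β μ K klE0) σ q₀ qv‖ := by
        rw [← mul_add, ← sum_add_distrib]
        congr 1
        refine sum_congr rfl fun a _ => ?_
        rw [← sum_add_distrib]
        exact sum_congr rfl fun bv _ => by ring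
      rw [this]
      linarith
    have hle : ∑ a : TorusSite 1 (2 * (2 * M)), ∑ bv : TorusSite 2 L,
        torusSiteDist bv 0 * ‖∑ q₀ : TorusSite 1 (2 * (2 * M)), ∑ qv : TorusSite 2 L, torusChar q₀ a * torusChar qv bv *
          gridSymbol L M (2 * (2 * M)) β (uvSymbolCT L M β μ K klE0) σ q₀ qv‖ ≤
        ∑ a : TorusSite 1 (2 * (2 * M)), ∑ bv : TorusSite 2 L, (|(((bv 0).valMinAbs : ℤ) : ℝ)| + |(((bv 1).valMinAbs : ℤ) : ℝ)|) *
          ‖∑ q₀ : TorusSite 1 (2 * (2 * M)), ∑ qv : TorusSite 2 L, torusChar q₀ a * torusChar qv bv *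
            gridSymbol L M (2 * (2 * M)) β (uvSymbolCT L M β μ K klE0) σ q₀ qv‖ := by
      refine sum_le_sum fun a _ => sum_le_sum fun bv _ => mul_le_mul_of_nonneg_right ?_ (norm_nonneg _)
      have h := torusSiteDist_le_abs_add_abs bv 0
      rwa [sub_zero] at h
    calc _ ≤ _ := hle
      _ ≤ (β / (((2 * (2 * M) : ℕ) : ℝ)))⁻¹ * (2 * XR) := (le_inv_mul_iff₀ (by positivity)).2 hsum
      _ = (((2 * (2 * M) : ℕ) : ℝ)) / β * (2 * XR) := by rw [inv_div]
  have hspace : ∑ X : GridLeg (GridPoint L (2 * (2 * M))), ‖G X Y‖ * torusSiteDist (X.1.1.2 - Y.1.1.2) 0 ≤ (((2 * (2 * M) : ℕ) : ℝ)) / β * (2 * XR) := by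
    have h := sum_norm_mul_gridSub_pullback_col_le_of_weight (L := L) (M := M) (N := (2 * (2 * M))) hβ0.ne' hMN (uvSymbolCT L M β μ K klE0)
      (fun _ bv => torusSiteDist bv 0) (fun a bv => by simp only [torusSiteDist_neg_zero]) hXsum Y
    rw [hGn]
    simpa only using h
  have hsplit : ∀ X : GridLeg (GridPoint L (2 * (2 * M))), ‖G X Y‖ * gridLabelWt L (2 * (2 * M)) β {gridLegPos X, gridLegPos Y} =
      ‖G X Y‖ + ‖G X Y‖ * (β / (((2 * (2 * M) : ℕ) : ℝ)) * cyclicDist (2 * (2 * M)) (((X.1.1.1 : ℕ) : ZMod (2 * (2 * M))) - ((Y.1.1.1 : ℕ) : ZMod (2 * (2 * M)))) 0) +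
        ‖G X Y‖ * torusSiteDist (X.1.1.2 - Y.1.1.2) 0 := by
    intro X
    rw [gridLabelWt_legPair_eq_split hβ0.le X Y]
    ring
  rw [sum_congr rfl fun X _ => hsplit X, sum_add_distrib, sum_add_distrib]
  have htot : (((2 * (2 * M) : ℕ) : ℝ)) / β * klScaleZeroA0 + (((2 * (2 * M) : ℕ) : ℝ)) / β * T + (((2 * (2 * M) : ℕ) : ℝ)) / β * (2 * XR) =
      (((2 * (2 * M) : ℕ) : ℝ)) / β * (klScaleZeroA0 + T + 2 * XR) := by ring
  rw [← htot]
  exact add_le_add (add_le_add hplain htime) hspace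

end AlphaW

end Summit.HubbardSuperconductivity.HubbardSuperconductivity.Theorems.EngineV8

end
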